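import Summits.HodgeConjecture.HodgeConjecture.Theorems.MarkmanPartnerTransportPicardThreeK3SquaresZeta9TypePicardTen
import Summits.HodgeConjecture.HodgeConjecture.Theorems.MarkmanPartnerTransportPicardThreeK3SquaresSqrt2Type
import HarnessLib

/-!
# Route MarkmanPartnerTransport · crux `PicardThreeK3Squares` (stmt-HodgeConjecture-19652) —
# the √2 type at Picard number 10: the annihilating quadratic is AUTOMATIC

Cell hodge-nonav, crux #4, INDEX row M-θ√2 (prover seat hodge-nonav-19652-p1 gen 12; `--supports
stmt-HodgeConjecture-19652`, helper). The √2 companion of `…Zeta9TypePicardTen`: for a √2 datum `θ`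
(`k3Form`-self-adjoint, kernel of rank `10`, `θ_ℂ³ = 2θ_ℂ`) and a marked projective K3 surface of Picard
number `10` whose endomorphism `t` (killing `N¹`) is conjugate by a rational isometry to `θ_ℂ`, the quadratic
`X² - 2` annihilates `t` on `T(S)` — so the hypotheses `P`, `P.Separable`, `P(0) ≠ 0`,
`IsAnnihilatedOnTranscendentalBy S t P` of `exists_sqrt2Type_hodgeConjectureFor_square` can be dropped at
`ρ(S) = 10`. The GENERATION clause is kept: at `ρ = 10` a quadratic eigenvalue does NOT force generation
(`22 - 10 = 12 = 2·2·3`, van Geemen's degree law allows `End_Hdg T(S)` of degree `4` or `6` over a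
`√2`-endomorphism), in accordance with the INDEX («generation NOT redundant for θ√2»).

* `quadratic_apply_eq_zero_of_orthogonal_ker` — `(θ_ℂ² - 2)v = 0` for `v` `k3Form`-orthogonal to
  `ker θ_ℂ` (self-adjoint, image in `ker θ_ℂ` by `θ³ = 2θ`, non-degeneracy).
* `aeval_quadratic_map_eq` — `(X² - 2)(f) = f² - 2`.
* **`isAnnihilatedOnTranscendentalBy_quadratic_of_sqrt2Model`** — `P(t) = 0` on `T(S)` for `P = X² - 2`
  when `ρ(S) = 10` (rank count `10 = 10` as in the ζ₉ case).
* **`exists_sqrt2Type_hodgeConjectureFor_square_of_picard_ten`** — THERE IS a √2 datum `θ` such that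
  every projective K3 surface `S` with `ρ(S) = 10`, marked, carrying an endomorphism `t` (rational,
  type-preserving, killing `N¹`, image `⊥ N¹`, GENERATING `End_Hdg T(S)`) conjugate by a rational isometry to
  `θ_ℂ`, satisfies `HodgeConjectureFor 4 (S ⊗ S)`. CONDITIONAL on {`Buskin2019_hodgeIsometry_algebraic`,
  `VanGeemenSchuett2025_sqrt2_cycleOnOpenPeriodSet`}; credits nothing; HC is NOT proved here.

No definition, no sorry.

References: van Geemen–Schütt, Forum Math. Sigma 13 (2025) e2, Thm. 1.2 (2), Prop. 6.2, §6.4, Rem. 6.5,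
§2.6; van Geemen, Michigan Math. J. 56 (2008), Lemma 3.2; Buskin, J. reine angew. Math. 755 (2019),
Thm. 1.1.
-/

set_option linter.dupNamespace false

noncomputable section

namespace Summit.HodgeConjecture.HodgeConjecture.Theorems.MarkmanPartnerTransport.RMTypeOrbit

open CategoryTheory MonoidalCategory Polynomial
open Literature.AlgebraicGeometry Literature.AlgebraicGeometry.Motives Literature.AlgebraicGeometry.HodgeTheory
open Literature.AlgebraicGeometry.Surfaces Literature.LinearAlgebra.QuadraticForm
open Literature.AlgebraicTopology.SingularHomology
open Summit.HodgeConjecture.HodgeConjecture.Theorems.NikulinTwinTransport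
open Summit.HodgeConjecture.HodgeConjecture.Theorems.MarkmanPartnerTransport.IsogenyInvariance
open Summit.HodgeConjecture.HodgeConjecture.Theorems.MarkmanPartnerTransport.RMTypeDescent

/-- `MarkedK3[S, η, p, x]`: VERBATIM the `let MarkedK3 := …` binder of the route declaration
`PicardThreeK3Squares` (as in `…RMTypeDescent`). Local notation only. -/
local notation3 (prettyPrint := false) "MarkedK3[" S ", " η ", " p ", " x "]" =>
  (p ≠ 0 ∧ (IsIntegralClass p ∧
    (∀ q : complexBetti S (2 * 2), IsIntegralClass q → ∃ n : ℤ, q = n • p) ∧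
    (∀ c : complexBetti S (2 * 1), IsIntegralClass c ↔ ∃ v : K3Index → ℤ, η c = fun i => (v i : ℂ)) ∧
    (∀ a b : complexBetti S (2 * 1),
      cupProduct (rfl : 2 * 1 + 2 * 1 = 2 * 2) a b = k3Form (η a) (η b) • p) ∧
    IsOfHodgeType 2 S (2 * 1) 2 0 (LinearEquiv.symm η x) ∧
    (∀ τ : complexBetti S (2 * 1), IsOfHodgeType 2 S (2 * 1) 2 0 τ →
      ∃ t : ℂ, τ = t • LinearEquiv.symm η x)) ∧
    (k3Form x x = 0 ∧ 0 < (k3Form (star x) x).re ∧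
      ∃ u : K3Index → ℤ, k3Form (fun i => (u i : ℂ)) x = 0 ∧ 0 < ∑ i, ∑ j, u i * k3Gram i j * u j))

/-- `Sqrt2Model[θ]`: VERBATIM the datum conjuncts of the named fact
`VanGeemenSchuett2025_sqrt2_cycleOnOpenPeriodSet` (as in `…Sqrt2Type`). Local notation only. -/
local notation3 (prettyPrint := false) "Sqrt2Model[" θ "]" =>
  ((∀ a b : K3Index → ℂ, k3Form (thetaC θ a) b = k3Form a (thetaC θ b)) ∧
    Module.finrank ℂ (LinearMap.ker (thetaC θ)) = 10 ∧
    thetaC θ ^ 3 = (2 : ℂ) • thetaC θ)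

/-- The quadratic `X² - 2 ∈ ℚ[X]`. Local notation only. -/
local notation3 (prettyPrint := false) "P₂" => (X ^ 2 - C (2 : ℚ) : ℚ[X])

variable {θ : Matrix K3Index K3Index ℚ}

/-- `(X² - 2)(f) = f² - 2·1` for an endomorphism `f` of a `ℂ`-vector space. [folklore] -/
theorem aeval_quadratic_map_eq {V : Type*} [AddCommGroup V] [Module ℂ V] (f : Module.End ℂ V) :
    Polynomial.aeval f ((P₂).map (algebraMap ℚ ℂ)) = f ^ 2 - (2 : ℂ) • 1 := by
  simp only [Polynomial.map_sub, Polynomial.map_pow, Polynomial.map_X, Polynomial.map_C, map_sub, map_pow,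
    Polynomial.aeval_X, Polynomial.aeval_C, Algebra.algebraMap_eq_smul_one]
  rw [Rat.smul_one_eq_cast, Rat.cast_ofNat]

/-- **`(θ_ℂ² - 2)v = 0` for every `v` that is `k3Form`-orthogonal to `ker θ_ℂ`** (√2 datum): the quadratic
operator is self-adjoint and `θ ∘ (θ² - 2) = θ³ - 2θ = 0`, so its image lies in `ker θ_ℂ`; non-degeneracy
of the K3 form concludes. Fact-free. [cite: GeemenSchutt2023, §2.1 and §6.4] -/
theorem quadratic_apply_eq_zero_of_orthogonal_ker (hZ : Sqrt2Model[θ]) {v : K3Index → ℂ}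
    (hv : ∀ w : K3Index → ℂ, thetaC θ w = 0 → k3Form v w = 0) :
    (thetaC θ ^ 2 - (2 : ℂ) • 1 : Module.End ℂ (K3Index → ℂ)) v = 0 := by
  obtain ⟨hθsa, -, hcube⟩ := hZ
  set Q : Module.End ℂ (K3Index → ℂ) := thetaC θ ^ 2 - (2 : ℂ) • 1 with hQ
  have hQsa : ∀ a b : K3Index → ℂ, k3Form (Q a) b = k3Form a (Q b) := by
    intro a b
    simp only [hQ, LinearMap.sub_apply, LinearMap.smul_apply, Module.End.one_apply, k3Form_sub_left,
      k3Form_smul_left, k3Form_sub_right', k3Form_smul_right, k3Form_pow_selfAdjoint hθsa]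
  have hmul : thetaC θ * Q = 0 := by
    rw [hQ, mul_sub, mul_smul_comm, mul_one, ← pow_succ', hcube, sub_self]
  have hker : ∀ w, thetaC θ (Q w) = 0 := fun w => by
    rw [← Module.End.mul_apply, hmul, LinearMap.zero_apply]
  refine k3FormC_nondegenerate.1 (Q v) fun w => ?_
  rw [k3FormC_apply, hQsa, hv (Q w) (hker w)]

variable {S : SchemeOver ℂ}

/-- **`P(t) = 0` on `T(S)` for `P = X² - 2`, for every K3 surface of Picard number `10` whose endomorphism
`t` (killing `N¹(S)`) is conjugate by a rational isometry `σ` of `Λ_ℚ` to a √2 model `θ_ℂ`.** With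
`A = σ ∘ η`: `A(N¹(S)_ℂ) = ker θ_ℂ` by the rank count `10 = 10`, so `A` maps `T(S)` into the
`k3Form`-orthogonal of `ker θ_ℂ`, where `θ² - 2` vanishes; pull back along the injective `A`. Fact-free.
[cite: GeemenSchutt2023, Thm. 1.2 (2), §2.1 and §6.4] -/
theorem isAnnihilatedOnTranscendentalBy_quadratic_of_sqrt2Model (hZ : Sqrt2Model[θ])
    (hρ : Module.finrank ℂ ↥(algebraicClasses S 1) = 10)
    (η : complexBetti S (2 * 1) ≃ₗ[ℂ] (K3Index → ℂ)) (p : complexBetti S (2 * 2)) (x : K3Index → ℂ)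
    (hM : MarkedK3[S, η, p, x])
    (t : complexBetti S (2 * 1) →ₗ[ℂ] complexBetti S (2 * 1))
    (ht_N : ∀ d ∈ algebraicClasses S 1, t d = 0)
    (σ : Module.End ℂ (K3Index → ℂ)) (hσ : ∀ a b, k3Form (σ a) (σ b) = k3Form a b)
    (hconj : ∀ c : complexBetti S (2 * 1), σ (η (t c)) = thetaC θ (σ (η c))) :
    IsAnnihilatedOnTranscendentalBy S t (P₂) := by
  classical
  have hfin : Module.finrank ℂ (LinearMap.ker (thetaC θ)) = 10 := hZ.2.1
  obtain ⟨hp0, ⟨-, -, -, hηcup, -, -⟩, -⟩ := hM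
  set A : complexBetti S (2 * 1) →ₗ[ℂ] (K3Index → ℂ) := σ ∘ₗ η.toLinearMap with hA
  have hAapp : ∀ c, A c = σ (η c) := fun c => rfl
  have hσinj : Function.Injective σ := injective_of_k3Form_isometry σ hσ
  have hAinj : Function.Injective A := fun a b hab => η.injective (hσinj hab)
  set N := algebraicClasses S 1 with hNdef
  have hle : N.map A ≤ LinearMap.ker (thetaC θ) := by
    rintro w ⟨d, hd, rfl⟩
    rw [LinearMap.mem_ker, hAapp, ← hconj, ht_N d hd, map_zero, map_zero]
  have heq : N.map A = LinearMap.ker (thetaC θ) := by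
    refine Submodule.eq_of_le_of_finrank_eq hle ?_
    rw [hfin, ← hρ]
    exact LinearEquiv.finrank_eq (Submodule.equivMapOfInjective A hAinj N).symm
  intro y hy
  have horth : ∀ w : K3Index → ℂ, thetaC θ w = 0 → k3Form (A y) w = 0 := by
    intro w hw
    have hw' : w ∈ N.map A := by rw [heq]; exact hw
    obtain ⟨d, hd, rfl⟩ := hw'
    rw [hAapp, hAapp, hσ]
    have hcup := hy d hd
    rw [hηcup] at hcup
    rcases smul_eq_zero.1 hcup with h | h
    · exact h
    · exact absurd h hp0
  have hQ := quadratic_apply_eq_zero_of_orthogonal_ker hZ horth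
  have hconjQ := conj_aeval_apply η t σ hconj ((P₂).map (algebraMap ℚ ℂ)) y
  rw [aeval_quadratic_map_eq (thetaC θ), ← hAapp, ← hAapp y, hQ] at hconjQ
  exact hAinj (by rw [map_zero]; exact hconjQ)

/-- **HC⁴(S ⊗ S) for every K3 surface of Picard number `10` of the van Geemen–Schütt √2 real-multiplication
type — with NO annihilating polynomial among the hypotheses** (the generation clause is kept: at `ρ = 10` a
quadratic eigenvalue does not force generation, `12 = 2·2·3`). THERE IS a √2 datum `θ` (as supplied by
`VanGeemenSchuett2025_sqrt2_cycleOnOpenPeriodSet`) such that every projective K3 surface `S` with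
`ρ(S) = 10`, marked by `(η, p, x)`, carrying an endomorphism `t` of `H²(S(ℂ); ℂ)` — rational, Hodge-type
preserving, killing `N¹H²`, with image cup-orthogonal to `N¹H²`, generating `End_Hdg T(S)` — which is
conjugate to `θ_ℂ` by a RATIONAL ISOMETRY `σ` of `Λ_ℚ`, satisfies `HodgeConjectureFor 4 (S ⊗ S)`:
`P = X² - 2` (separable, `P(0) = -2 ≠ 0`) annihilates `t` on `T(S)`
(`isAnnihilatedOnTranscendentalBy_quadratic_of_sqrt2Model`) and `exists_sqrt2Type_hodgeConjectureFor_square`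
applies. CONDITIONAL on {`Buskin2019_hodgeIsometry_algebraic`,
`VanGeemenSchuett2025_sqrt2_cycleOnOpenPeriodSet`}; credits nothing; HC is NOT proved here.
[cite: GeemenSchutt2023, Thm. 1.2 (2), Prop. 6.2, §6.4, Rem. 6.5] [cite: Vangeemen2008, Lemma 3.2]
[cite: Buskin2019, Thm. 1.1] -/
theorem exists_sqrt2Type_hodgeConjectureFor_square_of_picard_ten
    (hB : Buskin2019_hodgeIsometry_algebraic) (hV : VanGeemenSchuett2025_sqrt2_cycleOnOpenPeriodSet) :
    ∃ θ : Matrix K3Index K3Index ℚ, Sqrt2Model[θ] ∧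
      ∀ (S : SchemeOver ℂ) (_hS : IsK3Surface S) (_hρ : Module.finrank ℂ ↥(algebraicClasses S 1) = 10)
        (η : complexBetti S (2 * 1) ≃ₗ[ℂ] (K3Index → ℂ)) (p : complexBetti S (2 * 2)) (x : K3Index → ℂ)
        (_hM : MarkedK3[S, η, p, x])
        (t : complexBetti S (2 * 1) →ₗ[ℂ] complexBetti S (2 * 1))
        (_ht_rat : ∀ y, IsRationalClass y → IsRationalClass (t y))
        (_ht_typ : ∀ (i j : ℕ) (y : complexBetti S (2 * 1)),
          IsOfHodgeType 2 S (2 * 1) i j y → IsOfHodgeType 2 S (2 * 1) i j (t y))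
        (_ht_N : ∀ d ∈ algebraicClasses S 1, t d = 0)
        (_ht_perp : ∀ (y : complexBetti S (2 * 1)), ∀ d ∈ algebraicClasses S 1,
          cupProduct (rfl : 2 * 1 + 2 * 1 = 2 * 2) (t y) d = 0)
        (_hgen : TranscendentalEndomorphismsGeneratedBy S t)
        (σ : Module.End ℂ (K3Index → ℂ)) (_hσ : ∀ a b, k3Form (σ a) (σ b) = k3Form a b)
        (_hσrat : ∀ v : K3Index → ℤ, ∃ w : K3Index → ℚ, σ (fun i => (v i : ℂ)) = fun i => (w i : ℂ))
        (_hconj : ∀ c : complexBetti S (2 * 1), σ (η (t c)) = thetaC θ (σ (η c))),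
        HodgeConjectureFor 4 (S ⊗ S) := by
  classical
  obtain ⟨θ, hZ, hsq⟩ := exists_sqrt2Type_hodgeConjectureFor_square hB hV
  refine ⟨θ, hZ, ?_⟩
  intro S hS hρ η p x hM t ht_rat ht_typ ht_N ht_perp hgen σ hσ hσrat hconj
  have hP : IsAnnihilatedOnTranscendentalBy S t (P₂) :=
    isAnnihilatedOnTranscendentalBy_quadratic_of_sqrt2Model hZ hρ η p x hM t ht_N σ hσ hconj
  have hsep : (P₂).Separable := Polynomial.separable_X_pow_sub_C (2 : ℚ) (by norm_num) (by norm_num)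
  have h0 : (P₂).eval 0 ≠ 0 := by simp
  exact hsq S hS (P₂) hsep h0 η p x hM t ht_rat ht_typ ht_N ht_perp hP hgen σ hσ hσrat hconj

end Summit.HodgeConjecture.HodgeConjecture.Theorems.MarkmanPartnerTransport.RMTypeOrbit

end
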